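import Summits.BirchSwinnertonDyer.BirchSwinnertonDyer.Theses.ResidualThetaTransportAtTwo
import Summits.BirchSwinnertonDyer.BirchSwinnertonDyer.Theorems.ResidualThetaTransportAtTwoPollackPairKUnique
import Summits.BirchSwinnertonDyer.BirchSwinnertonDyer.Theorems.ResidualThetaTransportAtTwoThetaTransportIntegralSchurAtTwo
import Literature.NumberTheory.GaloisCohomology.PoitouTateSelmerStructuresCharacterLift
import HarnessLib

/-!
# Sketch — stub-ideation k = 4, gen 17 («assume-the-opposite») on `stub_cmLambdaLower`
# (skeleton `Cruxes/ResidualThetaCountLowerPureAtTwo/Lines/bt26_lambda.lean` v6; crux (R≥)ᵖ stmt-BirchSwinnertonDyer-26074;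
#  the stub IS `ResidualSignedLambdaLowerCMAtTwo` = RSL_g = stmt-BirchSwinnertonDyer-22608)

HONEST FRAMING.  Nothing here proves the stub, the crux, or BSD.  No `def`, no named fact, no instance; NO `sorry`:
the two helper lemmas of §4 (the algebraic shapes behind PLAN 2 / PLAN 3 of the card
`Ideas/stub-cmlambdalower-k4-g17.md`) are proved, everything is kernel-checked.

WHAT THIS FILE RECORDS (family 3 = counterexample / obstruction hunt at saturation, 55 prior cards):
* §1  the COUNTEREXAMPLE NORMAL FORM of RSL_g: only a datum with FINITE residual Selmer set can refute it
      (`le_encard_of_infinite`), so every «opposite» is a λ-defect at `μ = 0`, cotorsion.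
* §2  (O1) the DIAGONAL OBSTRUCTION of the levelwise deep-half supply (`hne` of
      `…DeepHalfValueTransfer.exists_iwasawaH1_locd₂_eq_of_levelwise_from_of_finiteDimensional`): in the abstract
      Poitou–Tate shape, `Sol(j,j) ≠ ∅ ↔ the obstruction character vanishes on the level-j dual Selmer group`
      (`solNonempty_iff_obstructionVanishes`) and the obstruction is the finite-level shadow of the route's
      orthogonality hypothesis under ANY value-compatible transfer (`obstructionVanishes_of_transfer`): the
      hypothesis `z ⊥ c₂(loc₂ SelRel)` is not only sufficient but NECESSARY level by level, and its test space
      cannot be shrunk (U69 of the critic's plan as a two-line theorem shape).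
* §3  (O2)/(O3) the other two residual «opposites» are closed BY NAME: Θ- and lattice-independence of the plus
      clause (`ThetaTransport.transportedKummer_iff_of_decomp_equivariant`, End_{D₂}(W[2^∞]) = ℤ₂) and the
      even-layer rigidity `⋂ₙ (ω̃ₙ⁺) = 0` in `𝒪⟦X⟧` at `p = 2` (`PollackPairK.eq_zero_of_forall_dvd_of_map_eq_X_pow`,
      `le_natDegree_cyclotomicOmegaPlus`), which turns finite-character agreements into identities in `Λ_𝒪`.
* §4  helper lemmas (proved): the algebraic shapes of PLAN 2 (character through the Kummer map) and PLAN 3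
      (even-layer congruences ⟹ identity in `Λ_𝒪`).
-/

set_option autoImplicit false
-- D-0017: single-problem summit, so the namespace repeats `BirchSwinnertonDyer` BY DESIGN.
set_option linter.dupNamespace false

namespace Summit.BirchSwinnertonDyer.BirchSwinnertonDyer.Cruxes.ResidualThetaCountLowerPureAtTwo.SideaK4G17

open Summit.BirchSwinnertonDyer.BirchSwinnertonDyer.Theses.ResidualThetaTransportAtTwo

/-! ## §0. Elaboration anchors: the stub's statement and the crux, BY NAME -/

example : ResidualSignedLambdaLowerCMAtTwo ↔ ResidualSignedLambdaLowerCMAtTwo := Iff.rfl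
example : ResidualThetaCountLowerPureAtTwo ↔ ResidualThetaCountLowerPureAtTwo := Iff.rfl

/-! ## §1. Counterexample normal form: an infinite residual Selmer set satisfies the inequality for free -/

/-- If the set on the right of RSL_g is infinite (`μ > 0` or positive `𝒪`-corank of `Sel⁺_{S₀}`), the inequality
`q^(d+Σ) ≤ encard` holds for every exponent: a counterexample must have FINITE `Sel⁺_{S₀}(ℚ_∞, A_g)[ϖ]`. -/
theorem le_encard_of_infinite {α : Type*} {s : Set α} (h : s.Infinite) (k : ℕ) :
    ((k : ℕ) : ℕ∞) ≤ s.encard := by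
  rw [h.encard_eq]
  exact le_top

/-! ## §2. (O1) The diagonal obstruction in abstract Poitou–Tate shape -/

section Diag

variable {H L HD LD : Type*} [AddCommGroup H] [AddCommGroup L] [AddCommGroup HD] [AddCommGroup LD]
variable {n : ℕ}

/-- **Sharpness of the diagonal criterion.**  `Sol` = global classes `x` satisfying the side conditions
(`side` = «in 𝓖, strict at S₀, unramified elsewhere») whose localisation at the distinguished place pairs with the
test subgroup `C` through the prescribed character `χ`; the OBSTRUCTION VANISHES when `χ` kills the localisations of
the dual Selmer classes `Y` landing in `C`.  With (B) = the one-place character lift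
(`SelmerComplement.exists_selmer_localTatePairing_eq_of_subgroup`, hypothesis `hB`) and (A) = reciprocity with the
other local terms vanishing (`SumLocalTermEqZero.sum_localTerm_selmer_eq_zero` restricted to `side`-classes against
`𝓕*`-classes, hypothesis `hA`), solvability at a level is EQUIVALENT to the vanishing of the obstruction character
on the dual Selmer group of that level.  [folklore Poitou–Tate; MilneADT2006 I.4.10] -/
theorem solNonempty_iff_obstructionVanishes (loc : H →+ L) (locD : HD →+ LD) (P : L →+ LD →+ ZMod n)
    (C : AddSubgroup LD) (χ : C →+ ZMod n) (side : H → Prop) (Y : Set HD)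
    (hA : ∀ x : H, side x → ∀ y ∈ Y, P (loc x) (locD y) = 0)
    (hB : (∀ y ∈ Y, ∀ hy : locD y ∈ C, χ ⟨locD y, hy⟩ = 0) →
      ∃ x : H, side x ∧ ∀ (c : LD) (hc : c ∈ C), P (loc x) c = χ ⟨c, hc⟩) :
    (∃ x : H, side x ∧ ∀ (c : LD) (hc : c ∈ C), P (loc x) c = χ ⟨c, hc⟩) ↔
      ∀ y ∈ Y, ∀ hy : locD y ∈ C, χ ⟨locD y, hy⟩ = 0 := by
  refine ⟨fun ⟨x, hx, hval⟩ y hy hyC => ?_, hB⟩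
  rw [← hval (locD y) hyC]
  exact hA x hx y hy

/-- **The obstruction is the finite-level shadow of the route's orthogonality hypothesis.**  For ANY transfer
`ι : Y → T` of level-`j` dual Selmer classes into the Λ-adic test space `T` (= `SelRel`) that is value-compatible
(`χ (locD y) = r (Z (ι y))`, `Z` = «`s ↦ c₂ z (loc₂ s)`», `r` = reduction to `ZMod n`), orthogonality of `z`
against ALL of `T` forces the obstruction to vanish.  Contrapositive = the family-3 reading: a level with
`Sol(j,j) = ∅` exhibits a class `s = ι y ∈ SelRel` with `c₂ z (loc₂ s) ≠ 0`. -/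
theorem obstructionVanishes_of_transfer (locD : HD →+ LD) (C : AddSubgroup LD) (χ : C →+ ZMod n) (Y : Set HD)
    {T V : Type*} [AddCommGroup V] (ι : HD → T) (Z : T → V) (r : V →+ ZMod n)
    (hval : ∀ y ∈ Y, ∀ hy : locD y ∈ C, χ ⟨locD y, hy⟩ = r (Z (ι y)))
    (horth : ∀ y ∈ Y, Z (ι y) = 0) :
    ∀ y ∈ Y, ∀ hy : locD y ∈ C, χ ⟨locD y, hy⟩ = 0 := by
  intro y hy hyC
  rw [hval y hy hyC, horth y hy, map_zero]

/-- Census bookkeeping: if the test space is SHRUNK to `Y' ⊆ Y`, reciprocity only certifies the obstruction on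
`Y'`; nothing is asserted on `Y ∖ Y'` (this is where a «⊥ Sg only» hypothesis would leave `hne` undecided —
critic U69 as a one-line shape). -/
theorem obstructionVanishes_mono {locD : HD →+ LD} {C : AddSubgroup LD} {χ : C →+ ZMod n} {Y Y' : Set HD}
    (hYY' : Y' ⊆ Y) (h : ∀ y ∈ Y, ∀ hy : locD y ∈ C, χ ⟨locD y, hy⟩ = 0) :
    ∀ y ∈ Y', ∀ hy : locD y ∈ C, χ ⟨locD y, hy⟩ = 0 :=
  fun y hy hyC => h y (hYY' hy) hyC

end Diag

/-! ## §3. (O2), (O3): the other two residual «opposites» are closed BY NAME -/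

/-- (O2) Θ- and lattice-independence of the coordinatewise plus-Kummer clause at `2` (End_{D₂}(W[2^∞]) = ℤ₂). -/
example := @Summit.BirchSwinnertonDyer.BirchSwinnertonDyer.Theorems.ThetaTransport.transportedKummer_iff_of_decomp_equivariant

/-- (O3) rigidity in `𝒪⟦X⟧` over a DVR: `x ∈ ⋂ₙ (Dₙ)`, `Dₙ ≡ X^{dₙ} (mod 𝔪)`, `dₙ → ∞` ⟹ `x = 0`; with
`Dₘ = X·ω̃⁺_{2m}` (degrees unbounded: `le_natDegree_cyclotomicOmegaPlus`) this is the even-layer identity principle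
at `p = 2` that upgrades finite-character agreements `Col⁺(z)(χ) = Lm(χ)` to an identity in `Λ_𝒪`. -/
example := @Summit.BirchSwinnertonDyer.BirchSwinnertonDyer.Theorems.PollackPairK.eq_zero_of_forall_dvd_of_map_eq_X_pow

example := @Summit.BirchSwinnertonDyer.BirchSwinnertonDyer.Theorems.PollackPairK.le_natDegree_cyclotomicOmegaPlus

/-- (O1) the one-place character lift itself (the `hB` of §2 in the tree's currency). -/
example := @Literature.NumberTheory.GaloisCohomology.LocalInvariants.SelmerComplement.exists_selmer_localTatePairing_eq_of_subgroup

/-! ## §4. Helper lemmas for PLAN 2 / PLAN 3 (abstract currency, PROVED)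

Both are stated over an abstract currency so that they elaborate here; the card says which tree objects
instantiate `F`, `G`, `D` (PLAN 3) and `κ`, `z`, `r` (PLAN 2). -/

section Helpers

open scoped PowerSeries

variable {O : Type*} [CommRing O] [IsDomain O] [IsDiscreteValuationRing O]

/-- helper (PLAN 3, even-layer congruences ⟹ identity): if `F − u·G` is divisible by every member of a family
`D m` whose reductions are `X^{d m}` with `d` unbounded, then `F = u·G`.  This is
`PollackPairK.eq_zero_of_forall_dvd_of_map_eq_X_pow` applied to `x = F − u·G`, kept as a NAMED signature so the
stub prover can cite the exact shape (instantiate `F = Col⁺(loc₂ z_Kato)`, `G = Lm`, `u` a unit,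
`D m = X·ω̃⁺_{2m}`, `d m ≥ m + 1` by `le_natDegree_cyclotomicOmegaPlus`). -/
theorem helper_eq_mul_of_forall_dvd_evenLayers (F G u : O⟦X⟧) (D : ℕ → O⟦X⟧) (d : ℕ → ℕ)
    (hD : ∀ m, PowerSeries.map (IsLocalRing.residue O) (D m) = PowerSeries.X ^ d m)
    (hd : ∀ N : ℕ, ∃ m, N < d m) (hdvd : ∀ m, D m ∣ F - u * G) : F = u * G :=
  sub_eq_zero.mp
    (Summit.BirchSwinnertonDyer.BirchSwinnertonDyer.Theorems.PollackPairK.eq_zero_of_forall_dvd_of_map_eq_X_pow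
      D d hD hd hdvd)

/-- helper (PLAN 2, the diagonal value identity, abstract): a functional `z` on layer points that kills the kernel
of the level-`j` Kummer map `κ` modulo `2^j` descends to a character `χ` of the Kummer subgroup with `χ ∘ κ = r ∘ z`
(`r` = reduction mod `2^j`).  Pure algebra; instantiated by the LEAD's `…ThetaKummerKernel` («hzker») it is the
`hval` of `obstructionVanishes_of_transfer`. -/
theorem helper_character_of_kills_kernel {Pts Hloc V : Type*} [AddCommGroup Pts] [AddCommGroup Hloc]
    [AddCommGroup V] {n : ℕ} (κ : Pts →+ Hloc) (z : Pts →+ V) (r : V →+ ZMod n)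
    (hker : ∀ Q, κ Q = 0 → r (z Q) = 0) :
    ∃ χ : κ.range →+ ZMod n, ∀ Q, χ ⟨κ Q, ⟨Q, rfl⟩⟩ = r (z Q) := by
  classical
  let s : κ.range → Pts := fun c => Classical.choose c.2
  have hs : ∀ c : κ.range, κ (s c) = c := fun c => Classical.choose_spec c.2
  have hwd : ∀ Q Q' : Pts, κ Q = κ Q' → r (z Q) = r (z Q') := by
    intro Q Q' h
    have h0 : κ (Q - Q') = 0 := by rw [map_sub, h, sub_self]
    have h1 := hker _ h0
    rwa [map_sub, map_sub, sub_eq_zero] at h1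
  refine ⟨AddMonoidHom.mk' (fun c => r (z (s c))) ?_, fun Q => ?_⟩
  · intro a b
    show r (z (s (a + b))) = r (z (s a)) + r (z (s b))
    rw [← map_add, ← map_add]
    apply hwd
    rw [map_add, hs, hs, hs]
    rfl
  · exact hwd _ _ (hs ⟨κ Q, ⟨Q, rfl⟩⟩)

end Helpers

end Summit.BirchSwinnertonDyer.BirchSwinnertonDyer.Cruxes.ResidualThetaCountLowerPureAtTwo.SideaK4G17
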